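import Summits.NavierStokesRegularity.NavierStokesRegularity.Theorems.NoOverheating.Negative.HiddenRSSWindowsExcluded
import Summits.NavierStokesRegularity.NavierStokesRegularity.Theorems.RdssProfileTruncation.Negative.FactorGuard

/-!
# KJ-42 — hidden-RSS window profiles with UNBOUNDED angular speeds are excluded at every window;
# with KJ-40, hidden rotated self-similarity lives eventually in Pineau–Vicol's middle band or nowhere

Refuter lineage, Negative lane of crux K2 `NoOverheating` of route `AngularGalerkinLadder`
(supports, does not decide).  KJ-40 (`HiddenRSSWindowsExcluded`) excluded admissible window
sequences of profiles that are rotated self-similar about axes `gₙe₃` with angular speeds `αₙ`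
(`(μ, gₙ R_{2αₙ log μ} gₙ⁻¹)`-RDSS for EVERY `μ > 1`) when the speeds are slow (`|αₙ| ≤ α₁(C₀)`) or
fast and bounded (`α₂(C₀) ≤ |αₙ| ≤ A`), and named two escapes: the open middle range, and
UNBOUNDED speeds along the sequence.  This file closes the second escape with Koch–Nadirashvili–
Seregin–Šverák instead of Pineau–Vicol:

* `isAxisymmetric_conj_of_hiddenRSS_unbounded` (§1, the mechanism): fields `uₙ` on the open past,
  jointly continuous, rotated self-similar about axes `gₙe₃` with speeds `|αₙ| → ∞`, `gₙ → g'`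
  pointwise, converging pointwise to a jointly continuous `v`: then every slice of `v` is
  AXISYMMETRIC about `g'e₃`.  Reason: for a fixed angle `θ₀` the hidden factors
  `μₙ = exp(θ₀ / 2αₙ) → 1` realise the rotation by `θ₀` (or, when `θ₀/αₙ < 0`, the factor `μₙ⁻¹ > 1`
  realises `−θ₀` and the symmetry is inverted), so `uₙ` is `(μₙ, gₙR_{θ₀}gₙ⁻¹)`-RDSS with factors
  tending to ONE; rotated self-similarity passes to pointwise limits on the open past also at the
  limiting factor `1` (`rotatedDSS_Iio_of_tendsto`), i.e. `v` is invariant under `g'R_{θ₀}g'⁻¹` —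
  for every `θ₀`.
* `no_windowSequence_hiddenRSS_unbounded` (§2): NO admissible window sequence (constants `0 < δ`,
  `εₙ → 0`, ANY window, any declared rotations, Type-I constant `C₀`) consists of hidden-RSS profiles
  with `|αₙ| → ∞`: re-declared at the hidden factor `2` (`isWindowProfile_redeclare`) the ladder
  limit (`exists_ladderLimit_typeI`) is a nontrivial Type-I ancient mild solution, axisymmetric about
  the limit axis by §1, which KNSS 2009 Thm 5.3/§6
  (`IsAncientMildSolution.ae_eq_zero_of_isAxisymmetric_conj_of_hasTypeIDecay`) forbids.
* `no_windowSequence_hiddenRSS_offBand` / `hiddenRSS_windowSequence_eventually_mem_band` (§3, the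
  census reading with KJ-40): with `α₁(C₀), α₂(C₀)` of KJ-40, an admissible window sequence of
  hidden-RSS profiles has its speeds EVENTUALLY in the open band `α₁ < |αₙ| < α₂` (subsequences of
  admissible sequences are admissible; a subsequence off the band is slow, fast-bounded or
  unbounded).  §4 reads this on the cruxes: `RungBlowupCofinal` together with a `NoOverheating` met
  by hidden-RSS window profiles whose speeds avoid the band is contradictory, for every window.

WHAT ESCAPES: hidden RSS with speeds eventually inside Pineau–Vicol's middle band (their
Conjecture 1.1 / Theorem 1.4 gap, open), and of course profiles with no hidden symmetry (coarse
windows, general rotations).  WHAT THIS IS NOT: not `¬NoOverheating`; no new Literature fact, no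
definition; standard axioms only.  The continuous-symmetry upgrade of §1 is the qualitative
(compactness) form of Pineau–Vicol's large-`|α|` heuristic "for `|α| ≫ 1` … `U` is almost
axisymmetric; if `U` were truly axisymmetric … `U ≡ 0`" (arXiv:2607.09619, §1.2 p. 5 and §6 p. 17),
made exact in the limit `|αₙ| → ∞` and closed by KNSS instead of their weighted energy estimate.
[cite: KochNadirashviliSereginSverak2009, Theorem 5.3 and §6 (arXiv:0709.3599)]
[cite: PineauVicol2026, §1.2 (p. 5) and §6 (p. 17): large |α| forces almost-axisymmetry]
[cite: PineauVicol2026, Theorem 1.4, Remark 1.5, Theorem 1.7 (i)–(ii) (arXiv:2607.09619 pp. 4–7)]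
[cite: BradshawTsai2017CPDE, §1 (v-RSS) (arXiv:1610.05680 p. 3)] -/

namespace Summit.NavierStokesRegularity.AngularGalerkinLadderHiddenRSSUnboundedSpeedsExcluded

open Set Filter MeasureTheory Topology Function
open Literature.Analysis Literature.Analysis.FluidPDE
open Summit.NavierStokesRegularity.FluidComputer
open Summit.NavierStokesRegularity.NavierStokesRegularity.Theses.AngularGalerkinLadder
open Summit.NavierStokesRegularity.AngularGalerkinLadderLadderLimit
open Summit.NavierStokesRegularity.AngularGalerkinLadderAxisymmetricWindowsExcluded
open Summit.NavierStokesRegularity.AngularGalerkinLadderHiddenRSSWindowsExcluded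
open Summit.NavierStokesRegularity.NavierStokesRegularity.Theorems

/-! ### §1 The mechanism: unbounded hidden speeds make pointwise limits axisymmetric -/

/-- **Continuous-symmetry upgrade.**  Let `uₙ` be jointly continuous fields on the open past,
rotated self-similar about the axes `gₙe₃` with angular speeds `αₙ ≠ 0`
(`(μ, gₙ R_{2αₙ log μ} gₙ⁻¹)`-RDSS for every `μ > 1`), with `|αₙ| → ∞` and `gₙ → g'` pointwise, and
let `uₙ → v` pointwise on the open past with `v` jointly continuous there.  Then every slice
`v(t)`, `t < 0`, is axisymmetric about the axis `g'e₃`: for each angle `θ₀` the factors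
`μₙ = exp(θ₀/2αₙ) → 1` (inverted when `θ₀/αₙ < 0`) exhibit `uₙ` as `(μₙ, gₙR_{θ₀}gₙ⁻¹)`-RDSS, and
rotated self-similarity passes to the limit at the limiting factor `1`
(`rotatedDSS_Iio_of_tendsto`).  (Qualitative form of Pineau–Vicol's "for `|α| ≫ 1`, `U` is almost
axisymmetric", arXiv:2607.09619 §1.2, §6.)
[cite: PineauVicol2026, §1.2 (p. 5) and §6 (p. 17)] -/
theorem isAxisymmetric_conj_of_hiddenRSS_unbounded {α : ℕ → ℝ}
    {g : ℕ → (EuclideanSpace ℝ (Fin 3) ≃ₗᵢ[ℝ] EuclideanSpace ℝ (Fin 3))}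
    {g' : EuclideanSpace ℝ (Fin 3) ≃ₗᵢ[ℝ] EuclideanSpace ℝ (Fin 3)}
    {u : ℕ → ℝ → EuclideanSpace ℝ (Fin 3) → EuclideanSpace ℝ (Fin 3)}
    {v : ℝ → EuclideanSpace ℝ (Fin 3) → EuclideanSpace ℝ (Fin 3)}
    (hcont : ∀ n, ContinuousOn (uncurry (u n)) (Iio 0 ×ˢ univ))
    (hRSS : ∀ n (μ : ℝ), 1 < μ →
      IsRotatedDSS μ (((g n).symm.trans (rotZLIE (2 * α n * Real.log μ))).trans (g n)) (u n))
    (hα0 : ∀ n, α n ≠ 0) (hα : Tendsto (fun n => |α n|) atTop atTop)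
    (hg : ∀ x, Tendsto (fun n => g n x) atTop (𝓝 (g' x)))
    (hv : ContinuousOn (uncurry v) (Iio 0 ×ˢ univ))
    (hlim : ∀ t < 0, ∀ x, Tendsto (fun n => u n t x) atTop (𝓝 (v t x))) :
    ∀ t < 0, IsAxisymmetric (fun y => g'.symm (v t (g' y))) := by
  -- invariance of `v` under the conjugated rotation by every fixed angle `θ₀`
  have hinv : ∀ θ₀ : ℝ, ∀ s < (0 : ℝ), ∀ x,
      g' (rotZ (-θ₀) (g'.symm (v s (g' (rotZ θ₀ (g'.symm x)))))) = v s x := by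
    intro θ₀
    by_cases hθ : θ₀ = 0
    · subst hθ
      intro s _ x
      simp
    -- the hidden factors `mₙ = exp (θ₀ / (2 αₙ)) → 1`
    obtain ⟨m, hm⟩ : ∃ m : ℕ → ℝ, ∀ n, m n = Real.exp (θ₀ / (2 * α n)) := ⟨_, fun n => rfl⟩
    have hm0 : ∀ n, 0 < m n := fun n => by rw [hm n]; exact Real.exp_pos _
    have hm1 : Tendsto m atTop (𝓝 1) := by
      have h0 : Tendsto (fun n => θ₀ / (2 * α n)) atTop (𝓝 0) := by
        rw [tendsto_zero_iff_norm_tendsto_zero]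
        have h := (tendsto_const_nhds : Tendsto (fun _ : ℕ => |θ₀|) atTop (𝓝 |θ₀|)).div_atTop
          (hα.const_mul_atTop (show (0 : ℝ) < 2 by norm_num))
        refine h.congr fun n => ?_
        rw [Real.norm_eq_abs, abs_div, abs_mul, abs_two]
      have h1 := (Real.continuous_exp.tendsto 0).comp h0
      rw [Real.exp_zero] at h1
      exact h1.congr fun n => (hm n).symm
    -- the conjugated rotations by `θ₀` about the moving axes converge pointwise
    have hS : ∀ x, Tendsto (fun n => (((g n).symm.trans (rotZLIE θ₀)).trans (g n)) x) atTop
        (𝓝 (((g'.symm.trans (rotZLIE θ₀)).trans g') x)) := fun x => by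
      have h1 : Tendsto (fun n => rotZ θ₀ ((g n).symm x)) atTop (𝓝 (rotZ θ₀ (g'.symm x))) :=
        ((continuous_rotZ θ₀).tendsto _).comp (tendsto_linearIsometryEquiv_symm_apply hg x)
      simpa only [LinearIsometryEquiv.trans_apply, rotZLIE_apply] using
        tendsto_linearIsometryEquiv_apply_of_tendsto hg h1
    -- every `uₙ` is `(mₙ, gₙ R_{θ₀} gₙ⁻¹)`-RDSS
    have hdss : ∀ n, ∀ t < (0 : ℝ), ∀ x,
        m n • (((g n).symm.trans (rotZLIE θ₀)).trans (g n)).symm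
          (u n (m n ^ 2 * t) (m n • (((g n).symm.trans (rotZLIE θ₀)).trans (g n)) x)) = u n t x := by
      intro n t _ x
      rcases lt_or_gt_of_ne (div_ne_zero hθ (mul_ne_zero two_ne_zero (hα0 n)) :
          θ₀ / (2 * α n) ≠ 0) with hneg | hpos
      · -- factor below one: the hidden RSS at `(m n)⁻¹ > 1` realises the angle `-θ₀`; invert it
        have hμ : 1 < (m n)⁻¹ := by
          rw [hm n, ← Real.exp_neg]
          exact Real.one_lt_exp_iff.2 (by linarith)
        have hang : 2 * α n * Real.log (m n)⁻¹ = -θ₀ := by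
          rw [hm n, Real.log_inv, Real.log_exp]
          field_simp [hα0 n]
        have key := RdssProfileTruncation.Negative.isRotatedDSS_inv' (hRSS n _ hμ)
          (inv_ne_zero (hm0 n).ne')
        rw [inv_inv, hang] at key
        simpa only [LinearIsometryEquiv.symm_symm, LinearIsometryEquiv.symm_trans,
          LinearIsometryEquiv.trans_apply, rotZLIE_apply, rotZLIE_symm_apply, neg_neg] using key t x
      · have hμ : 1 < m n := by
          rw [hm n]
          exact Real.one_lt_exp_iff.2 hpos
        have hang : 2 * α n * Real.log (m n) = θ₀ := by
          rw [hm n, Real.log_exp]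
          field_simp [hα0 n]
        have key := hRSS n _ hμ
        rw [hang] at key
        exact key t x
    -- pass to the limit at the limiting factor `1`
    have key := rotatedDSS_Iio_of_tendsto (c := m) (c' := 1)
      (R := fun n => ((g n).symm.trans (rotZLIE θ₀)).trans (g n))
      (R' := (g'.symm.trans (rotZLIE θ₀)).trans g') (u := u) (v := v)
      one_pos hm1 hS hdss hcont hv hlim
    intro s hs x
    simpa only [one_smul, one_pow, one_mul, LinearIsometryEquiv.symm_trans,
      LinearIsometryEquiv.trans_apply, LinearIsometryEquiv.symm_symm, rotZLIE_apply,
      rotZLIE_symm_apply] using key s hs x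
  -- axisymmetry of the conjugated slices
  intro t ht θ y
  show g'.symm (v t (g' (rotZ θ y))) = rotZ θ (g'.symm (v t (g' y)))
  have h1 := hinv θ t ht (g' y)
  rw [LinearIsometryEquiv.symm_apply_apply] at h1
  have h2 : g'.symm (v t (g' y)) = rotZ (-θ) (g'.symm (v t (g' (rotZ θ y)))) := by
    rw [← h1, LinearIsometryEquiv.symm_apply_apply]
  rw [h2, ← rotZ_add, add_neg_cancel, rotZ_zero]

/-! ### §2 No admissible window sequence of hidden-RSS profiles with unbounded speeds -/

/-- **No admissible window sequence of hidden-RSS profiles with UNBOUNDED angular speeds — any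
window.**  Constants `0 < δ`, `εₙ → 0`, any window and declared rotations, a window rung profile
with Type-I constant `C₀` at every index which is rotated self-similar about an axis `gₙe₃` with
angular speed `αₙ` (`(μ, gₙ R_{2αₙ log μ} gₙ⁻¹)`-RDSS for every `μ > 1`), and `|αₙ| → ∞`, are
contradictory: re-declared at the hidden factor `2`, the ladder limit along a subsequence with
convergent axes is a nontrivial Type-I ancient mild solution (`exists_ladderLimit_typeI`),
axisymmetric about the limit axis (`isAxisymmetric_conj_of_hiddenRSS_unbounded`), contradicting
KNSS 2009 Thm 5.3/§6.
[cite: KochNadirashviliSereginSverak2009, Theorem 5.3 and §6]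
[cite: BradshawTsai2017CPDE, §1 (v-RSS)] -/
theorem no_windowSequence_hiddenRSS_unbounded {C₀ cmin cmax δ : ℝ} {L : ℕ → ℕ} {ε c α : ℕ → ℝ}
    {R g : ℕ → (EuclideanSpace ℝ (Fin 3) ≃ₗᵢ[ℝ] EuclideanSpace ℝ (Fin 3))}
    {u : ℕ → ℝ → EuclideanSpace ℝ (Fin 3) → EuclideanSpace ℝ (Fin 3)}
    {p : ℕ → ℝ → EuclideanSpace ℝ (Fin 3) → ℝ}
    {d : ℕ → ℝ → EuclideanSpace ℝ (Fin 3) → EuclideanSpace ℝ (Fin 3)}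
    (hδ : 0 < δ) (hε : Tendsto ε atTop (𝓝 0))
    (hW : ∀ n, AngularLadder.IsWindowProfile (L n) C₀ cmin cmax δ (ε n) (c n) (R n) (u n) (p n)
      (d n))
    (hRSS : ∀ n (μ : ℝ), 1 < μ →
      IsRotatedDSS μ (((g n).symm.trans (rotZLIE (2 * α n * Real.log μ))).trans (g n)) (u n))
    (hα : Tendsto (fun n => |α n|) atTop atTop) : False := by
  -- (a) discard the indices with `|αₙ| < 1`
  obtain ⟨φa, hφa, hαa⟩ : ∃ φa : ℕ → ℕ, StrictMono φa ∧ ∀ n, 1 ≤ |α (φa n)| :=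
    extraction_of_eventually_atTop (hα.eventually_ge_atTop 1)
  -- (b) the axes converge along a further subsequence (compactness of the isometry group)
  obtain ⟨φb, g', hφb, -, hg'⟩ := exists_subseq_tendsto_linearIsometryEquiv fun n => g (φa n)
  have hψ : StrictMono (φa ∘ φb) := hφa.comp hφb
  -- (c) re-declare at the hidden factor `2` (window `[2, 2]`) and pass to the ladder limit
  have h2 : (1 : ℝ) < 2 := by norm_num
  have hW2 : ∀ n, AngularLadder.IsWindowProfile (L (φa (φb n))) C₀ 2 2 δ (ε (φa (φb n))) 2
      (((g (φa (φb n))).symm.trans (rotZLIE (2 * α (φa (φb n)) * Real.log 2))).trans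
        (g (φa (φb n)))) (u (φa (φb n))) (p (φa (φb n))) (d (φa (φb n))) := fun n =>
    isWindowProfile_redeclare h2 (hW _) (hRSS _ 2 h2)
  obtain ⟨φ₁, -, -, v, hφ₁, -, -, -, hptw, -, hvcont, -, hTAM, hmeas, -, hvTI, -, hnz⟩ :=
    exists_ladderLimit_typeI (L := fun n => L (φa (φb n))) (ε := fun n => ε (φa (φb n)))
      (c := fun _ => (2 : ℝ))
      (R := fun n => ((g (φa (φb n))).symm.trans
        (rotZLIE (2 * α (φa (φb n)) * Real.log 2))).trans (g (φa (φb n))))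
      (u := fun n => u (φa (φb n))) (p := fun n => p (φa (φb n))) (d := fun n => d (φa (φb n)))
      h2 hδ (hε.comp hψ.tendsto_atTop) hW2
  -- (d) the limit is axisymmetric about the limit axis `g'e₃`
  have hax : ∀ t < 0, IsAxisymmetric (fun y => g'.symm (v t (g' y))) :=
    isAxisymmetric_conj_of_hiddenRSS_unbounded (α := fun n => α (φa (φb (φ₁ n))))
      (g := fun n => g (φa (φb (φ₁ n)))) (u := fun n => u (φa (φb (φ₁ n))))
      (fun n => (hW _).1.classical.smooth_velocity.continuousOn)
      (fun n μ hμ => hRSS _ μ hμ)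
      (fun n h0 => by
        have h1 := hαa (φb (φ₁ n))
        rw [h0, abs_zero] at h1
        exact absurd h1 (by norm_num))
      (hα.comp (hψ.comp hφ₁).tendsto_atTop)
      (fun x => (hg' x).comp hφ₁.tendsto_atTop) hvcont hptw
  -- (e) KNSS 2009 Thm 5.3/§6 about the axis `g'e₃`
  exact hnz (hTAM.isAncientMildSolution.ae_eq_zero_of_isAxisymmetric_conj_of_hasTypeIDecay hmeas g'
    hax hvTI)

/-! ### §3 With KJ-40: the speeds of hidden-RSS window sequences are eventually in the middle band -/

/-- **No admissible window sequence of hidden-RSS profiles with speeds OFF Pineau–Vicol's middle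
band — any window.**  With `α₁(C₀)` (slow threshold, Thm 1.7 (i)) and `α₂(C₀)` (fast threshold,
Thm 1.7 (ii)) of KJ-40: an admissible window sequence of hidden-RSS profiles all of whose speeds
satisfy `|αₙ| ≤ α₁ ∨ α₂ ≤ |αₙ|` is contradictory — a subsequence is slow
(`no_windowSequence_hiddenRSS_slow`), fast and bounded (`no_windowSequence_hiddenRSS_fast`) or has
unbounded speeds (`no_windowSequence_hiddenRSS_unbounded`), and subsequences of admissible window
sequences are admissible.
[cite: PineauVicol2026, Theorem 1.4 and Theorem 1.7 (i)–(ii)]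
[cite: KochNadirashviliSereginSverak2009, Theorem 5.3 and §6] -/
theorem no_windowSequence_hiddenRSS_offBand (C₀ : ℝ) :
    ∃ α₁ α₂ : ℝ, 0 < α₁ ∧ 0 < α₂ ∧ ∀ {cmin cmax δ : ℝ} {L : ℕ → ℕ} {ε c α : ℕ → ℝ}
      {R g : ℕ → (EuclideanSpace ℝ (Fin 3) ≃ₗᵢ[ℝ] EuclideanSpace ℝ (Fin 3))}
      {u : ℕ → ℝ → EuclideanSpace ℝ (Fin 3) → EuclideanSpace ℝ (Fin 3)}
      {p : ℕ → ℝ → EuclideanSpace ℝ (Fin 3) → ℝ}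
      {d : ℕ → ℝ → EuclideanSpace ℝ (Fin 3) → EuclideanSpace ℝ (Fin 3)},
      0 < δ → Tendsto ε atTop (𝓝 0) →
      (∀ n, AngularLadder.IsWindowProfile (L n) C₀ cmin cmax δ (ε n) (c n) (R n) (u n) (p n)
        (d n)) →
      (∀ n (μ : ℝ), 1 < μ → IsRotatedDSS μ
        (((g n).symm.trans (rotZLIE (2 * α n * Real.log μ))).trans (g n)) (u n)) →
      (∀ n, |α n| ≤ α₁ ∨ α₂ ≤ |α n|) → False := by
  obtain ⟨α₁, hα₁, Hslow⟩ := no_windowSequence_hiddenRSS_slow C₀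
  obtain ⟨α₂, hα₂, Hfast⟩ := no_windowSequence_hiddenRSS_fast C₀
  refine ⟨α₁, α₂, hα₁, hα₂, fun {cmin cmax δ L ε c α R g u p d} hδ hε hW hRSS hoff => ?_⟩
  by_cases hfreq : ∃ᶠ n in atTop, |α n| ≤ α₁
  · -- a slow subsequence
    obtain ⟨φ, hφ, hφα⟩ := extraction_of_frequently_atTop hfreq
    exact Hslow (α := fun n => α (φ n)) (g := fun n => g (φ n)) hδ (hε.comp hφ.tendsto_atTop)
      (fun n => hW (φ n)) (fun n μ hμ => hRSS (φ n) μ hμ) hφα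
  -- eventually fast
  have hev : ∀ᶠ n in atTop, α₂ ≤ |α n| :=
    (not_frequently.1 hfreq).mono fun n hn => (hoff n).resolve_left hn
  obtain ⟨φ, hφ, hφα⟩ := extraction_of_eventually_atTop hev
  by_cases hunb : Tendsto (fun n => |α (φ n)|) atTop atTop
  · -- unbounded speeds along the fast subsequence
    exact no_windowSequence_hiddenRSS_unbounded (α := fun n => α (φ n)) (g := fun n => g (φ n))
      hδ (hε.comp hφ.tendsto_atTop) (fun n => hW (φ n)) (fun n μ hμ => hRSS (φ n) μ hμ) hunb
  · -- a bounded fast sub-subsequence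
    obtain ⟨A, hA⟩ : ∃ A : ℝ, ∃ᶠ n in atTop, |α (φ n)| ≤ A := by
      by_contra hcon
      refine hunb (tendsto_atTop.2 fun A => ?_)
      have h : ¬ ∃ᶠ n in atTop, |α (φ n)| ≤ A := fun h => hcon ⟨A, h⟩
      exact (not_frequently.1 h).mono fun n hn => (not_le.1 hn).le
    obtain ⟨φ', hφ', hφ'α⟩ := extraction_of_frequently_atTop hA
    exact Hfast A (α := fun n => α (φ (φ' n))) (g := fun n => g (φ (φ' n))) hδ
      (hε.comp (hφ.comp hφ').tendsto_atTop) (fun n => hW (φ (φ' n)))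
      (fun n μ hμ => hRSS (φ (φ' n)) μ hμ) (fun n => hφα (φ' n)) hφ'α

/-- **The speeds of an admissible hidden-RSS window sequence are EVENTUALLY in the middle band**
`α₁(C₀) < |αₙ| < α₂(C₀)` (contrapositive of `no_windowSequence_hiddenRSS_offBand` along the
off-band subsequence).  This is the window-sequence form of "hidden rotated self-similarity lives in
Pineau–Vicol's middle range or nowhere".
[cite: PineauVicol2026, Theorem 1.4 and Theorem 1.7 (i)–(ii)]
[cite: KochNadirashviliSereginSverak2009, Theorem 5.3 and §6] -/
theorem hiddenRSS_windowSequence_eventually_mem_band (C₀ : ℝ) :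
    ∃ α₁ α₂ : ℝ, 0 < α₁ ∧ 0 < α₂ ∧ ∀ {cmin cmax δ : ℝ} {L : ℕ → ℕ} {ε c α : ℕ → ℝ}
      {R g : ℕ → (EuclideanSpace ℝ (Fin 3) ≃ₗᵢ[ℝ] EuclideanSpace ℝ (Fin 3))}
      {u : ℕ → ℝ → EuclideanSpace ℝ (Fin 3) → EuclideanSpace ℝ (Fin 3)}
      {p : ℕ → ℝ → EuclideanSpace ℝ (Fin 3) → ℝ}
      {d : ℕ → ℝ → EuclideanSpace ℝ (Fin 3) → EuclideanSpace ℝ (Fin 3)},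
      0 < δ → Tendsto ε atTop (𝓝 0) →
      (∀ n, AngularLadder.IsWindowProfile (L n) C₀ cmin cmax δ (ε n) (c n) (R n) (u n) (p n)
        (d n)) →
      (∀ n (μ : ℝ), 1 < μ → IsRotatedDSS μ
        (((g n).symm.trans (rotZLIE (2 * α n * Real.log μ))).trans (g n)) (u n)) →
      ∀ᶠ n in atTop, α₁ < |α n| ∧ |α n| < α₂ := by
  obtain ⟨α₁, α₂, hα₁, hα₂, H⟩ := no_windowSequence_hiddenRSS_offBand C₀
  refine ⟨α₁, α₂, hα₁, hα₂, fun {cmin cmax δ L ε c α R g u p d} hδ hε hW hRSS => ?_⟩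
  by_contra hne
  obtain ⟨φ, hφ, hφα⟩ := extraction_of_frequently_atTop (not_eventually.1 hne)
  refine H (α := fun n => α (φ n)) (g := fun n => g (φ n)) hδ (hε.comp hφ.tendsto_atTop)
    (fun n => hW (φ n)) (fun n μ hμ => hRSS (φ n) μ hμ) fun n => ?_
  rcases le_or_gt |α (φ n)| α₁ with h | h
  · exact Or.inl h
  · exact Or.inr (not_lt.1 fun h' => hφα n ⟨h, h'⟩)

/-! ### §4 Read on the open cruxes -/

/-- **K1 ∧ (K2 met by hidden-RSS window profiles with speeds off the middle band) is FALSE — any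
window.**  With `α₁(C₀), α₂(C₀)` as above: `RungBlowupCofinal` and a `NoOverheating`-type supply of
window rung profiles (constant `C₀`, any window), each rotated self-similar about some axis with a
speed `|α| ≤ α₁` or `|α| ≥ α₂`, are contradictory.
[cite: PineauVicol2026, Theorem 1.4 and Theorem 1.7 (i)–(ii)]
[cite: KochNadirashviliSereginSverak2009, Theorem 5.3 and §6] -/
theorem not_cofinal_and_noOverheating_hiddenRSS_offBand (C₀ : ℝ) :
    ∃ α₁ α₂ : ℝ, 0 < α₁ ∧ 0 < α₂ ∧ ¬ (RungBlowupCofinal ∧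
      ∃ (cmin cmax δ : ℝ) (L₀ : ℕ) (ε : ℕ → ℝ), 0 < δ ∧ Tendsto ε atTop (𝓝 0) ∧
        ∀ L ≥ L₀, AngularLadder.RungIsSingular L →
          ∃ (c : ℝ) (R : EuclideanSpace ℝ (Fin 3) ≃ₗᵢ[ℝ] EuclideanSpace ℝ (Fin 3))
            (u : ℝ → EuclideanSpace ℝ (Fin 3) → EuclideanSpace ℝ (Fin 3))
            (p : ℝ → EuclideanSpace ℝ (Fin 3) → ℝ)
            (d : ℝ → EuclideanSpace ℝ (Fin 3) → EuclideanSpace ℝ (Fin 3))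
            (g : EuclideanSpace ℝ (Fin 3) ≃ₗᵢ[ℝ] EuclideanSpace ℝ (Fin 3)) (α : ℝ),
            AngularLadder.IsWindowProfile L C₀ cmin cmax δ (ε L) c R u p d ∧
              (∀ μ : ℝ, 1 < μ →
                IsRotatedDSS μ ((g.symm.trans (rotZLIE (2 * α * Real.log μ))).trans g) u) ∧
              (|α| ≤ α₁ ∨ α₂ ≤ |α|)) := by
  obtain ⟨α₁, α₂, hα₁, hα₂, H⟩ := no_windowSequence_hiddenRSS_offBand C₀
  refine ⟨α₁, α₂, hα₁, hα₂, ?_⟩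
  rintro ⟨h₁, cmin, cmax, δ, L₀, ε, hδ, hε, hwin⟩
  choose L hLge hLsing using fun n : ℕ => h₁ (max L₀ n)
  choose c R u p d g α hW hRSS hoff using fun n : ℕ =>
    hwin (L n) (le_trans (le_max_left _ _) (hLge n)) (hLsing n)
  have hε' : Tendsto (fun n : ℕ => ε (L n)) atTop (𝓝 0) :=
    hε.comp (tendsto_atTop_mono (fun n => le_trans (le_max_right _ _) (hLge n)) tendsto_id)
  exact H hδ hε' hW hRSS hoff

/-- **Census reading (no cofinality needed): under a hidden-RSS supply, the speeds at the singular
rungs are eventually in the band.**  If every singular rung `L ≥ L₀` carries a window rung profile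
(constant `C₀`, window `[cmin, cmax]`, defect sizes `ε L → 0`) that is rotated self-similar about
some axis with speed `αL L`, then for all large `L`: `RungIsSingular L → α₁ < |αL L| < α₂`.
[cite: PineauVicol2026, Theorem 1.4 and Theorem 1.7 (i)–(ii)]
[cite: KochNadirashviliSereginSverak2009, Theorem 5.3 and §6] -/
theorem hiddenRSS_supply_speeds_eventually_mem_band (C₀ : ℝ) :
    ∃ α₁ α₂ : ℝ, 0 < α₁ ∧ 0 < α₂ ∧ ∀ {cmin cmax δ : ℝ} {L₀ : ℕ} {ε αL : ℕ → ℝ},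
      0 < δ → Tendsto ε atTop (𝓝 0) →
      (∀ L ≥ L₀, AngularLadder.RungIsSingular L →
        ∃ (c : ℝ) (R : EuclideanSpace ℝ (Fin 3) ≃ₗᵢ[ℝ] EuclideanSpace ℝ (Fin 3))
          (u : ℝ → EuclideanSpace ℝ (Fin 3) → EuclideanSpace ℝ (Fin 3))
          (p : ℝ → EuclideanSpace ℝ (Fin 3) → ℝ)
          (d : ℝ → EuclideanSpace ℝ (Fin 3) → EuclideanSpace ℝ (Fin 3))
          (g : EuclideanSpace ℝ (Fin 3) ≃ₗᵢ[ℝ] EuclideanSpace ℝ (Fin 3)),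
          AngularLadder.IsWindowProfile L C₀ cmin cmax δ (ε L) c R u p d ∧
            ∀ μ : ℝ, 1 < μ →
              IsRotatedDSS μ ((g.symm.trans (rotZLIE (2 * αL L * Real.log μ))).trans g) u) →
      ∀ᶠ L in atTop, AngularLadder.RungIsSingular L → α₁ < |αL L| ∧ |αL L| < α₂ := by
  obtain ⟨α₁, α₂, hα₁, hα₂, H⟩ := no_windowSequence_hiddenRSS_offBand C₀
  refine ⟨α₁, α₂, hα₁, hα₂, fun {cmin cmax δ L₀ ε αL} hδ hε hsup => ?_⟩
  by_contra hne
  obtain ⟨φ, hφ, hφP⟩ := extraction_of_frequently_atTop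
    ((not_eventually.1 hne).and_eventually (eventually_ge_atTop L₀))
  have hsing : ∀ n, AngularLadder.RungIsSingular (φ n) := fun n => (Classical.not_imp.1 (hφP n).1).1
  have hband : ∀ n, ¬ (α₁ < |αL (φ n)| ∧ |αL (φ n)| < α₂) := fun n => (Classical.not_imp.1 (hφP n).1).2
  choose c R u p d g hW hRSS using fun n : ℕ => hsup (φ n) (hφP n).2 (hsing n)
  refine H (α := fun n => αL (φ n)) (g := g) hδ (hε.comp hφ.tendsto_atTop) hW hRSS fun n => ?_
  rcases le_or_gt |αL (φ n)| α₁ with h | h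
  · exact Or.inl h
  · exact Or.inr (not_lt.1 fun h' => hband n ⟨h, h'⟩)

end Summit.NavierStokesRegularity.AngularGalerkinLadderHiddenRSSUnboundedSpeedsExcluded
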